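import Literature.Barriers.CriticalPhenomena.WeaklySAWProgressiveIntegration
import HarnessLib

/-!
# BBS 2015, §5.1, eqs. (5.2)–(5.3): progressive integration `Z_N = E_{C_N}θ ∘ ⋯ ∘ E_{C₁}θ Z₀`

Bauerschmidt–Brydges–Slade, CMP 337 (2015), arXiv:1403.7422, §5.1: given a decomposition
`C = Σ_{j=1}^N C_j` of the covariance into covariances with positive-definite parts ((5.2)),
Proposition 5.1 iterates to `E_Cθ F = (E_{C_N}θ ∘ ⋯ ∘ E_{C₁}θ) F`, in particular
`Z_N = E_Cθ Z₀ = E_{C_N}θ ∘ ⋯ ∘ E_{C₁}θ Z₀` ((5.3)) — "the basis for the renormalisation group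
analysis". This file derives (5.3) from `convTheta_convTheta` (`WeaklySAWProgressiveIntegration.lean`)
for real symmetric positive-definite kinetic matrices `A_j = C_j⁻¹`:

* `RealPosDef.convMatrix`: the class of real symmetric positive-definite matrices (with explicit lower
  bound) is closed under `(A₁, A₂) ↦ A₁(A₁+A₂)⁻¹A₂ = (A₁⁻¹ + A₂⁻¹)⁻¹` (bound `min(c₁,c₂)/2`, from the
  completed square `quadForm_sub_add_quadForm`);
* `kinFold A₁ [A_N, …, A₂]` — the kinetic matrix of `C₁ + ⋯ + C_N` (`inv_kinFold`: its inverse is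
  `Σ_j A_j⁻¹`), and `convThetaFold A₁ F [A_N, …, A₂] = E_{C_N}θ (⋯ (E_{C₂}θ (E_{C₁}θ F)))`;
* **`convThetaFold_eq`**: `E_{C_N}θ ∘ ⋯ ∘ E_{C₁}θ F = E_{C₁+⋯+C_N}θ F` for every form `F` with
  continuous coefficients of polynomial growth — eq. (5.3).

Everything is proved; no named facts.
-/

noncomputable section

open MeasureTheory Complex ComplexConjugate
open Literature.MathematicalPhysics.QuantumLattice
open Literature.MathematicalPhysics.QuantumLattice.GrassmannAlgebra (grassmannBasis)
open scoped BigOperators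

namespace Literature.Barriers.CriticalPhenomena

namespace CTWSAW

section Iterated

variable {Λ : Type*} [LinearOrder Λ] [Fintype Λ]

variable {A₁ A₂ : Matrix Λ Λ ℂ} {c₁ c₂ : ℝ}

omit [LinearOrder Λ] in
/-- `0 B 0̄ = 0`. [folklore] -/
theorem quadForm_zero_right (B : Matrix Λ Λ ℂ) : Boson.quadForm B 0 = 0 := by
  simp [Boson.quadForm]

/-- **The composed kinetic matrix `A₁(A₁+A₂)⁻¹A₂ = (A₁⁻¹+A₂⁻¹)⁻¹` is again real symmetric
positive-definite**, with lower bound `min(c₁,c₂)/2`: from the completed square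
`ξAξ̄ = (ξ-u)A₁(ξ̄-ū) + uA₂ū`, `u = (A₁+A₂)⁻¹A₁ξ`. [folklore] -/
theorem RealPosDef.convMatrix (h₁ : RealPosDef A₁ c₁) (h₂ : RealPosDef A₂ c₂) :
    RealPosDef (convMatrix A₁ A₂) (min c₁ c₂ / 2) := by
  have hB : RealPosDef (A₁ + A₂) (c₁ + c₂) := h₁.add h₂
  have hBu : IsUnit (A₁ + A₂).det := hB.isUnit_det
  have hBir : ∀ x y, conj ((A₁ + A₂)⁻¹ x y) = (A₁ + A₂)⁻¹ x y := conj_inv_apply hB.real hBu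
  refine ⟨?_, ?_, ?_, ?_⟩
  · rw [convMatrix_eq_sub hBu, Matrix.transpose_sub, Matrix.transpose_mul, Matrix.transpose_mul,
      Matrix.transpose_nonsing_inv, hB.symm, h₁.symm, Matrix.mul_assoc]
  · intro x y
    rw [convMatrix_eq_sub hBu, Matrix.sub_apply, map_sub, h₁.real, conj_mul_apply (conj_mul_apply h₁.real hBir) h₁.real]
  · exact half_pos (lt_min h₁.pos h₂.pos)
  · intro φ
    set u : Λ → ℂ := (A₁ + A₂)⁻¹.mulVec (A₁.mulVec φ) with hu
    have key := quadForm_sub_add_quadForm h₁ h₂ φ u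
    rw [sub_self, quadForm_zero_right, zero_add] at key
    rw [← key, Complex.add_re]
    have ha := h₁.bound (φ - u)
    have hb := h₂.bound u
    have hsq : ∀ x, ‖φ x‖ ^ 2 ≤ 2 * ‖(φ - u) x‖ ^ 2 + 2 * ‖u x‖ ^ 2 := by
      intro x
      have h := norm_add_le ((φ - u) x) (u x)
      rw [Pi.sub_apply, sub_add_cancel] at h
      rw [Pi.sub_apply]
      nlinarith [sq_nonneg (‖φ x - u x‖ - ‖u x‖), norm_nonneg (φ x - u x), norm_nonneg (u x), norm_nonneg (φ x)]
    have hsum : ∑ x, ‖φ x‖ ^ 2 ≤ 2 * ∑ x, ‖(φ - u) x‖ ^ 2 + 2 * ∑ x, ‖u x‖ ^ 2 := by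
      rw [Finset.mul_sum, Finset.mul_sum, ← Finset.sum_add_distrib]
      exact Finset.sum_le_sum fun x _ => hsq x
    have hapos : 0 ≤ ∑ x, ‖(φ - u) x‖ ^ 2 := Finset.sum_nonneg fun x _ => by positivity
    have hbpos : 0 ≤ ∑ x, ‖u x‖ ^ 2 := Finset.sum_nonneg fun x _ => by positivity
    have hmin₁ : min c₁ c₂ ≤ c₁ := min_le_left _ _
    have hmin₂ : min c₁ c₂ ≤ c₂ := min_le_right _ _
    have hmin : 0 ≤ min c₁ c₂ := (lt_min h₁.pos h₂.pos).le
    nlinarith [mul_le_mul_of_nonneg_right hmin₁ hapos, mul_le_mul_of_nonneg_right hmin₂ hbpos,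
      mul_le_mul_of_nonneg_left hsum hmin]

/-- **The kinetic matrix of the summed covariance**: `kinFold A₁ [A_N, …, A₂]` with
`(kinFold A₁ [A_N, …, A₂])⁻¹ = A₁⁻¹ + A₂⁻¹ + ⋯ + A_N⁻¹` (`inv_kinFold`); the list is ordered outermost
integration first. [cite: BauerschmidtBrydgesSlade2015LogCorr, §5.1, eq. (5.2) (C = Σ_j C_j)] -/
def kinFold (A₀ : Matrix Λ Λ ℂ) : List (Matrix Λ Λ ℂ) → Matrix Λ Λ ℂ
  | [] => A₀
  | A :: As => CTWSAW.convMatrix (kinFold A₀ As) A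

/-- **The progressive integration `E_{C_N}θ ∘ ⋯ ∘ E_{C₂}θ ∘ E_{C₁}θ F`** (`A_j = C_j⁻¹`; the list
`[A_N, …, A₂]` is ordered outermost first, `A₁` is the innermost convolution).
[cite: BauerschmidtBrydgesSlade2015LogCorr, §5.1, eq. (5.3)] -/
def convThetaFold (A₀ : Matrix Λ Λ ℂ) (F : SForm Λ) : List (Matrix Λ Λ ℂ) → SForm Λ
  | [] => convTheta A₀ F
  | A :: As => convTheta A (convThetaFold A₀ F As)

/-- The composed kinetic matrices stay real symmetric positive-definite. [folklore] -/
theorem exists_realPosDef_kinFold {A₀ : Matrix Λ Λ ℂ} {c₀ : ℝ} (h₀ : RealPosDef A₀ c₀) :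
    ∀ {As : List (Matrix Λ Λ ℂ)}, (∀ A ∈ As, ∃ c, RealPosDef A c) → ∃ c, RealPosDef (kinFold A₀ As) c
  | [], _ => ⟨c₀, h₀⟩
  | A :: As, hAs => by
    obtain ⟨c, hc⟩ := exists_realPosDef_kinFold h₀ (As := As) fun A' hA' => hAs A' (List.mem_cons_of_mem _ hA')
    obtain ⟨c', hc'⟩ := hAs A List.mem_cons_self
    exact ⟨_, hc.convMatrix hc'⟩

/-- **The covariances add**: `(kinFold A₁ [A_N, …, A₂])⁻¹ = A₁⁻¹ + (A_N⁻¹ + ⋯ + A₂⁻¹)`.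
[cite: BauerschmidtBrydgesSlade2015LogCorr, §5.1, eq. (5.2)] -/
theorem inv_kinFold {A₀ : Matrix Λ Λ ℂ} {c₀ : ℝ} (h₀ : RealPosDef A₀ c₀) :
    ∀ {As : List (Matrix Λ Λ ℂ)}, (∀ A ∈ As, ∃ c, RealPosDef A c) →
      (kinFold A₀ As)⁻¹ = A₀⁻¹ + (As.map fun A => A⁻¹).sum
  | [], _ => by simp [kinFold]
  | A :: As, hAs => by
    have hAs' : ∀ A' ∈ As, ∃ c, RealPosDef A' c := fun A' hA' => hAs A' (List.mem_cons_of_mem _ hA')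
    obtain ⟨c, hc⟩ := exists_realPosDef_kinFold h₀ hAs'
    obtain ⟨c', hc'⟩ := hAs A List.mem_cons_self
    rw [kinFold, inv_convMatrix hc.isUnit_det hc'.isUnit_det (hc.add hc').isUnit_det, inv_kinFold h₀ hAs',
      List.map_cons, List.sum_cons]
    abel

/-- **BBS 2015, eq. (5.3): `E_{C_N}θ ∘ ⋯ ∘ E_{C₁}θ F = E_{C₁+⋯+C_N}θ F`** (progressive Gaussian
integration; Proposition 5.1 iterated), for real symmetric positive-definite `A_j = C_j⁻¹` and every
form `F` with continuous coefficients of polynomial growth; the kinetic matrix of the total covariance is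
`kinFold A₁ [A_N, …, A₂]` (`inv_kinFold`). [cite: BauerschmidtBrydgesSlade2015LogCorr, §5.1, eqs. (5.2)-(5.3)] -/
theorem convThetaFold_eq {A₀ : Matrix Λ Λ ℂ} {c₀ : ℝ} (h₀ : RealPosDef A₀ c₀) {F : SForm Λ}
    (hFc : ∀ u, Continuous ((grassmannBasis (FieldFun Λ) (Λ ⊕ₗ Λ)).repr F u))
    (hFb : ∀ u, ∃ K : ℝ, ∃ k : ℕ, ∀ x, ‖(grassmannBasis (FieldFun Λ) (Λ ⊕ₗ Λ)).repr F u x‖ ≤ K * (1 + ‖x‖) ^ k) :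
    ∀ {As : List (Matrix Λ Λ ℂ)}, (∀ A ∈ As, ∃ c, RealPosDef A c) →
      convThetaFold A₀ F As = convTheta (kinFold A₀ As) F
  | [], _ => rfl
  | A :: As, hAs => by
    have hAs' : ∀ A' ∈ As, ∃ c, RealPosDef A' c := fun A' hA' => hAs A' (List.mem_cons_of_mem _ hA')
    obtain ⟨c, hc⟩ := exists_realPosDef_kinFold h₀ hAs'
    obtain ⟨c', hc'⟩ := hAs A List.mem_cons_self
    rw [convThetaFold, convThetaFold_eq h₀ hFc hFb hAs', convTheta_convTheta hc hc' hFc hFb, kinFold]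

end Iterated

end CTWSAW

end Literature.Barriers.CriticalPhenomena
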